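import Literature.AlgebraicGeometry.Motives.ComplexAutGaloisDescent
import Literature.AlgebraicGeometry.Motives.ComplexPointsZariskiDense
import Literature.AlgebraicGeometry.Morphisms.SeparatedRigidityDedekind
import HarnessLib

/-!
# Descent of morphisms `X_ℂ → Y_ℂ` commuting with `Aut(ℂ/K)` on a complex-DENSE set of points

Topic `AlgebraicGeometry/Motives`, namespace `Literature.AlgebraicGeometry.Motives.GaloisDescent`
(sequel of `Motives/ComplexAutGaloisDescent`). THEOREMS ONLY (no definition, no named fact, no
instance, no `sorry`).

Let `K` be a COUNTABLE field with `[Algebra K ℂ]`, `X`, `Y` schemes over `K`,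
`X_ℂ = (bcFunctor K ℂ).obj X = X ×_K Spec ℂ` with `X_ℂ` reduced and locally of finite type over `ℂ`,
`Y → Spec K` separated, and `g : X_ℂ ⟶ Y_ℂ` a `ℂ`-morphism. The tree's
`GaloisDescent.existsUnique_map_eq_complex` ([Milne2005ShimuraVarieties] Prop. 13.1) descends `g`
to a unique `K`-morphism `X ⟶ Y` as soon as `gal σ ≫ g = g ≫ gal σ` for every `σ ∈ Aut(ℂ/K)`
(`gal σ = 1 × Spec σ⁻¹`, `Motives/JacobianGaloisDescent`). This file weakens that hypothesis to the
form in which it is checked for Shimura varieties ([Milne2005ShimuraVarieties] proof of Thm. 13.6,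
p. 118: «it suffices to show that `σ(T(g)) = T(g)` …», checked on the special points, which are
Zariski dense, with Lemma 13.5: complex-dense ⇒ Zariski-dense): it is enough that `g` commute with
the action of `Aut(ℂ/K)` on the complex POINTS of a subset `T ⊆ X_ℂ(ℂ)` which is DENSE for the
complex (strong) topology — the action being the LEFT action `σ • P = Spec σ ≫ P` on `X(ℂ)`
(`AlgPoints.instMulActionAlgEquiv`) transported to `X_ℂ(ℂ)` by
`AlgPoints.baseChangeEquiv (algebraMap K ℂ) X : X(ℂ) ≃ X_ℂ(ℂ)` (`Motives/BaseChange`).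

* `GaloisDescent.baseChangeEquiv_smul_symm_left` — on underlying morphisms `Spec ℂ ⟶ X_ℂ` the
  transported action is `P ↦ Spec σ ≫ P ≫ gal σ` (cf. `AlgPoints.baseChangeEquiv_left_comp_gal`,
  `Motives/ComplexPointsGaloisUnderlying`);
* `GaloisDescent.comp_gal_comp_eq_of_map_smul_eq` — so the pointwise commutation of `g` with `σ`
  at `P` says `P ≫ gal σ ≫ g = P ≫ g ≫ gal σ`;
* `GaloisDescent.gal_comp_eq_comp_gal_of_dense_complex` — hence, if it holds on a complex-dense
  `T`, then `gal σ ≫ g = g ≫ gal σ` (two morphisms from the reduced `X_ℂ` to `Y_ℂ`, separated over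
  `Spec ℂ`, agreeing after every point of the Zariski-dense set `pt(T)` — tree
  `Motives.dense_image_pt_of_dense` and `Morphisms.ext_of_dense_of_forall_exists_comp_eq`);
* **`GaloisDescent.existsUnique_map_eq_of_dense_complex`** — the descent statement: leaf (T1) of
  the I-1′ programme (canonical models of unitary Shimura varieties, closure-descent step S3:
  transition maps and class-group translations commute with `Aut(ℂ/E)` on the dense special
  points, hence descend to `E`), signature as registered by its planning workfile
  `Cruxes/HDel/Lines/F1ExtHodgeType.lean` v3 (cell `hodgecm-mathlib`, banked generic leaf toward
  I-1′ S3; no floor change).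

## References
* [Milne2005ShimuraVarieties] J. S. Milne, *Introduction to Shimura Varieties* (2005, rev. 2017),
  §13: Prop. 13.1 p. 117, Lemma 13.5 p. 118, proof of Thm. 13.6 p. 118.
* [Deligne1971TravauxShimura] P. Deligne, *Travaux de Shimura*, Sém. Bourbaki 389 (1971), 5.2
  p. 155, Cor. 5.7 p. 156.
-/

set_option autoImplicit false

noncomputable section

open CategoryTheory CategoryTheory.Limits AlgebraicGeometry Cardinal

namespace Literature.AlgebraicGeometry.Motives

namespace GaloisDescent

open AbelianVariety (bcSpec bcFunctor specAut specAut_comp_specAut_symm specAut_symm_comp_specAut)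

set_option backward.isDefEq.respectTransparency false

variable {K : Type} [Field K] [Algebra K ℂ]

/-! ### The transported action of `Aut(ℂ/K)` on `X_ℂ(ℂ)`, on underlying morphisms -/

section Points

variable (X : SchemeOver K)

/-- **The action of `Aut(ℂ/K)` on `X_ℂ(ℂ)` transported from the left action on `X(ℂ)`, on
underlying morphisms.** For `σ ∈ Aut(ℂ/K)` and a complex point `P : Spec ℂ ⟶ X_ℂ` of
`X_ℂ = X ×_K Spec ℂ`, the point `(σ • (P ≫ pr), 1)` of `X_ℂ(ℂ)` corresponding under
`AlgPoints.baseChangeEquiv` to `σ` applied to the point `P ≫ pr ∈ X(ℂ)` has underlying morphism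
`Spec σ ≫ P ≫ gal σ` (check on the two projections: `gal σ ≫ pr = pr`,
`gal σ ≫ pr₂ = pr₂ ≫ Spec σ⁻¹`; cf. `AlgPoints.baseChangeEquiv_left_comp_gal`).
[cite: Milne2005ShimuraVarieties, §13 Prop. 13.1 p. 117 («the actions of Aut(Ω/k) on V(Ω)»)] -/
theorem baseChangeEquiv_smul_symm_left (σ : ℂ ≃ₐ[K] ℂ)
    (P : ComplexPoints ((bcFunctor K ℂ).obj X)) :
    (AlgPoints.baseChangeEquiv (algebraMap K ℂ) X
        (σ • (AlgPoints.baseChangeEquiv (algebraMap K ℂ) X).symm P)).left =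
      specAut ℂ σ ≫ P.left ≫ gal ℂ X σ := by
  apply pullback.hom_ext
  · -- first projection: both sides are `Spec σ ≫ P ≫ pr`
    have h1 : (AlgPoints.baseChangeEquiv (algebraMap K ℂ) X
          (σ • (AlgPoints.baseChangeEquiv (algebraMap K ℂ) X).symm P)).left ≫
          pullback.fst X.hom (bcSpec K ℂ) =
        (σ • (AlgPoints.baseChangeEquiv (algebraMap K ℂ) X).symm P).left :=
      AlgPoints.baseChangeEquiv_apply_left_comp_fst (algebraMap K ℂ) X _
    rw [h1]
    erw [AlgPoints.smul_left, AlgPoints.baseChangeEquiv_symm_apply_left]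
    simp only [Category.assoc]
    erw [gal_fst]
    rfl
  · -- second projection: both sides are the identity of `Spec ℂ`
    have h2 : (AlgPoints.baseChangeEquiv (algebraMap K ℂ) X
          (σ • (AlgPoints.baseChangeEquiv (algebraMap K ℂ) X).symm P)).left ≫
          pullback.snd X.hom (bcSpec K ℂ) =
        Spec.map (CommRingCat.ofHom (algebraMap ℂ ℂ)) :=
      Over.w _
    have hP : P.left ≫ pullback.snd X.hom (bcSpec K ℂ) =
        Spec.map (CommRingCat.ofHom (algebraMap ℂ ℂ)) := Over.w P
    rw [h2]
    simp only [Category.assoc]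
    rw [gal_snd, reassoc_of% hP, Algebra.algebraMap_self, CommRingCat.ofHom_id]
    erw [Spec.map_id]
    change 𝟙 (Spec (.of ℂ)) = specAut ℂ σ ≫ 𝟙 (Spec (.of ℂ)) ≫ specAut ℂ σ⁻¹
    rw [Category.id_comp]
    exact (specAut_comp_specAut_symm ℂ σ).symm

variable {X} {Y : SchemeOver K}

/-- **Pointwise commutation with `σ` in terms of morphisms.** For `g : X_ℂ ⟶ Y_ℂ`, `σ ∈ Aut(ℂ/K)`
and a complex point `P` of `X_ℂ`: if `g` commutes with `σ` at `P` for the transported actions on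
`X_ℂ(ℂ)`, `Y_ℂ(ℂ)` — `g (σ ⋆ P) = σ ⋆ g(P)` with `σ ⋆ Q := (σ • (Q ≫ pr), 1)` — then
`P ≫ gal σ ≫ g = P ≫ g ≫ gal σ` (underlying morphisms of both sides, `Spec σ` cancelled).
[cite: Milne2005ShimuraVarieties, §13 Prop. 13.1 p. 117] -/
theorem comp_gal_comp_eq_of_map_smul_eq (g : (bcFunctor K ℂ).obj X ⟶ (bcFunctor K ℂ).obj Y)
    (σ : ℂ ≃ₐ[K] ℂ) (P : ComplexPoints ((bcFunctor K ℂ).obj X))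
    (h : AlgPoints.map g (AlgPoints.baseChangeEquiv (algebraMap K ℂ) X
        (σ • (AlgPoints.baseChangeEquiv (algebraMap K ℂ) X).symm P)) =
      AlgPoints.baseChangeEquiv (algebraMap K ℂ) Y
        (σ • (AlgPoints.baseChangeEquiv (algebraMap K ℂ) Y).symm (AlgPoints.map g P))) :
    P.left ≫ gal ℂ X σ ≫ g.left = P.left ≫ g.left ≫ gal ℂ Y σ := by
  have hs := specAut_symm_comp_specAut ℂ σ
  have h' := congrArg
    (fun Q : ComplexPoints ((bcFunctor K ℂ).obj Y) => specAut ℂ σ⁻¹ ≫ Q.left) h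
  simpa only [AlgPoints.map, Over.comp_left, baseChangeEquiv_smul_symm_left, Category.assoc,
    reassoc_of% hs] using h'

end Points

/-! ### Commutation with `gal σ` from a complex-dense set of points, and descent -/

section Descent

variable {X Y : SchemeOver K}

/-- **Commutation with `Aut(ℂ/K)` on a complex-dense set of points implies `gal σ ≫ g = g ≫ gal σ`.**
Let `X_ℂ` be reduced and locally of finite type over `ℂ`, `Y` separated over `K`,
`g : X_ℂ ⟶ Y_ℂ`, and `T ⊆ X_ℂ(ℂ)` dense for the complex topology. If `g` commutes with every
`σ ∈ Aut(ℂ/K)` at every point of `T` (transported actions), then `gal σ ≫ g = g ≫ gal σ` for every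
`σ`: the two sides are morphisms from the reduced scheme `X_ℂ` agreeing over `Spec ℂ`
(`Y_ℂ → Spec ℂ` separated) and after composition with every point `Spec ℂ ⟶ X_ℂ` of `T`
(`comp_gal_comp_eq_of_map_smul_eq`), whose underlying points are ZARISKI dense
(`Motives.dense_image_pt_of_dense`, [Milne2005ShimuraVarieties] Lemma 13.5); conclude by
`Morphisms.ext_of_dense_of_forall_exists_comp_eq`.
[cite: Milne2005ShimuraVarieties, §13 Lemma 13.5 p. 118, proof of Thm. 13.6 p. 118]
[cite: Deligne1971TravauxShimura, 5.2 p. 155] -/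
theorem gal_comp_eq_comp_gal_of_dense_complex [IsReduced (bc ℂ X)] [IsSeparated Y.hom]
    [LocallyOfFiniteType ((bcFunctor K ℂ).obj X).hom]
    (g : (bcFunctor K ℂ).obj X ⟶ (bcFunctor K ℂ).obj Y)
    {T : Set (ComplexPoints ((bcFunctor K ℂ).obj X))} (hT : Dense T)
    (h : ∀ (σ : ℂ ≃ₐ[K] ℂ), ∀ P ∈ T,
      AlgPoints.map g (AlgPoints.baseChangeEquiv (algebraMap K ℂ) X
          (σ • (AlgPoints.baseChangeEquiv (algebraMap K ℂ) X).symm P)) =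
        AlgPoints.baseChangeEquiv (algebraMap K ℂ) Y
          (σ • (AlgPoints.baseChangeEquiv (algebraMap K ℂ) Y).symm (AlgPoints.map g P)))
    (σ : ℂ ≃ₐ[K] ℂ) : gal ℂ X σ ≫ g.left = g.left ≫ gal ℂ Y σ := by
  -- both sides lie over `pr₂ ≫ Spec σ⁻¹ : X_ℂ ⟶ Spec ℂ`
  have hg : g.left ≫ pullback.snd Y.hom (bcSpec K ℂ) = pullback.snd X.hom (bcSpec K ℂ) :=
    Over.w g
  have H' : (gal ℂ X σ ≫ g.left) ≫ pullback.snd Y.hom (bcSpec K ℂ) =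
      (g.left ≫ gal ℂ Y σ) ≫ pullback.snd Y.hom (bcSpec K ℂ) := by
    simp only [Category.assoc, gal_snd, hg, reassoc_of% hg]
  refine Literature.AlgebraicGeometry.Morphisms.ext_of_dense_of_forall_exists_comp_eq
    (gal ℂ X σ ≫ g.left) (g.left ≫ gal ℂ Y σ) (pullback.snd Y.hom (bcSpec K ℂ)) H'
    (AlgPoints.pt '' T) (dense_image_pt_of_dense (X := (bcFunctor K ℂ).obj X) hT) ?_
  rintro _ ⟨P, hP, rfl⟩
  refine ⟨Spec (.of ℂ), P.left, ⟨IsLocalRing.closedPoint ℂ, ?_⟩, ?_⟩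
  · rfl
  · exact comp_gal_comp_eq_of_map_smul_eq g σ P (h σ P hP)

/-- **Descent of morphisms commuting with `Aut(ℂ/K)` on a complex-dense set of points (leaf (T1)
of the I-1′ programme).** Let `K` be a countable field with `[Algebra K ℂ]`, `X`, `Y` schemes over
`K` with `X_ℂ = (bcFunctor K ℂ).obj X` reduced and locally of finite type over `ℂ` and `Y → Spec K`
separated, `g : X_ℂ ⟶ Y_ℂ` a `ℂ`-morphism, and `T ⊆ X_ℂ(ℂ)` a subset DENSE for the complex
topology. If for every `σ ∈ Aut(ℂ/K)` and every `P ∈ T`,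
`g (bce_X (σ • bce_X⁻¹ P)) = bce_Y (σ • bce_Y⁻¹ (g P))`, where
`bce_Z = AlgPoints.baseChangeEquiv (algebraMap K ℂ) Z : Z(ℂ) ≃ Z_ℂ(ℂ)` and `σ • ·` is the left
action on `Z(ℂ)`, then `g` is the base change of a UNIQUE `K`-morphism `X ⟶ Y`. Proof: by
`gal_comp_eq_comp_gal_of_dense_complex` the hypothesis of the tree's
`GaloisDescent.existsUnique_map_eq_complex` ([Milne2005ShimuraVarieties] Prop. 13.1) holds. This is
the form in which Prop. 13.1 is applied to Shimura varieties ([Milne2005ShimuraVarieties] proof of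
Thm. 13.6 p. 118: «it suffices to show that `σ(T(g)) = T(g)` for all automorphisms `σ` of `ℂ`
fixing `E(G,X)`», checked on the Zariski-dense special points, Lemma 13.5; [Deligne1971] 5.2,
Cor. 5.7).
[cite: Milne2005ShimuraVarieties, §13 Prop. 13.1 p. 117, Lemma 13.5 p. 118, proof of Thm. 13.6 p. 118]
[cite: Deligne1971TravauxShimura, 5.2 p. 155, Cor. 5.7 p. 156] -/
theorem existsUnique_map_eq_of_dense_complex (hK : #K ≤ ℵ₀) {X Y : SchemeOver K}
    [IsReduced (bc ℂ X)] [IsSeparated Y.hom] [LocallyOfFiniteType ((bcFunctor K ℂ).obj X).hom]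
    (g : (bcFunctor K ℂ).obj X ⟶ (bcFunctor K ℂ).obj Y)
    {T : Set (ComplexPoints ((bcFunctor K ℂ).obj X))} (hT : Dense T)
    (h : ∀ (σ : ℂ ≃ₐ[K] ℂ), ∀ P ∈ T,
      AlgPoints.map g (AlgPoints.baseChangeEquiv (algebraMap K ℂ) X
          (σ • (AlgPoints.baseChangeEquiv (algebraMap K ℂ) X).symm P)) =
        AlgPoints.baseChangeEquiv (algebraMap K ℂ) Y
          (σ • (AlgPoints.baseChangeEquiv (algebraMap K ℂ) Y).symm (AlgPoints.map g P))) :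
    ∃! f : X ⟶ Y, (bcFunctor K ℂ).map f = g :=
  existsUnique_map_eq_complex hK g (gal_comp_eq_comp_gal_of_dense_complex g hT h)

end Descent

end GaloisDescent

end Literature.AlgebraicGeometry.Motives

end
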